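import Literature.Computability.AlgebraicComplexity.OneSliceSpeedup
import Literature.Computability.AlgebraicComplexity.TensorRestrictionRank
import Literature.Computability.AlgebraicComplexity.FlatteningBound
import HarnessLib

/-!
# Direct sums of one-slice tensors `⊕_α ⟨1, s_α, 1⟩`, in coordinates

Topic `Literature/Computability/AlgebraicComplexity` (family `MatrixMultiplication`). Source of the
notion: J. Alman, B. Li, *Asymptotic Rank Speedup Theorems, Revisited*, arXiv:2605.21738 (2026) (held
text `paper:arxiv-2605.21738`): the one-slice matrix multiplication tensor `⟨1,s,1⟩` (§5.3, p. 13) and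
the DIRECT SUMS of such slices that the speedup theorems append — `⊕_α ⟨1, s_α, 1⟩`,
`⊕_α ⟨1, r_α + s_α − 2n, 1⟩` (Thm. 6.3, p. 15 L104–109), `p ⊙ ⟨1,s,1⟩` (§6, p. 16 L57–62) and
`⊕_{α,β} ⟨1,(n_α−1)(m_β−1),1⟩`, `pq ⊙ ⟨1,(n−1)(m−1),1⟩` (Thm. 7.3, p. 19 L89–110).

## The coordinate form (one definition)

For a block map `g : τ → ν` on finite index types, `blockSliceTensor K g : τ → τ → ν → K` has entry
`1` at `(x, x, g x)` and `0` elsewhere: the block-diagonal identity matrix whose diagonal block over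
`c ∈ ν` is the identity on the fibre `g⁻¹(c)`, each block carrying its own (third-mode) variable
`w_c` — i.e. `⊕_{c ∈ ν} ⟨1, |g⁻¹(c)|, 1⟩` with the trivial mode THIRD (the convention of
`AlmanLi2026AppendSlice.lean`: `⟨1,s,1⟩ = rotate (oneSliceTensor K σ)`). Dependent block sizes need no
`Σ`-types: the sizes are the fibre cardinalities of `g`.

API (all `0/1` relabelling identities or zeroing-out restrictions, Bläser 2013 Def. 7.2 / Lemma 5.4):
* `blockSliceTensor_const` — one block (`ν = Unit`): `= rotate (oneSliceTensor K τ)` (`⟨1,|τ|,1⟩`);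
* `blockSliceTensor_sumMap` — blocks split as `ν₁ ⊕ ν₂` (`Sum.map g₁ g₂`): `= directSumTensor` of the two block tensors
  (so `⊕` over a two-element family is the tree's binary `⊕`);
* `blockSliceTensor_fst` — equal blocks (`τ = Fin p × σ`, `g = Prod.fst`):
  `= ⟨p⟩ ⊠ rotate (oneSliceTensor K σ)` up to the trivial relabelling `Fin p × Unit ≃ Fin p` of the
  third mode (the paper's `p ⊙ ⟨1,s,1⟩`), with the two restrictions between them;
* `tensorRestrictsTo_blockSliceTensor_of_comp_eq` — monotonicity: an injection of index sets
  compatible with an injection of block labels is a restriction (delete the other coordinates).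

## References

* J. Alman, B. Li, arXiv:2605.21738 (2026), §5.3 (`⟨1,s,1⟩`), Thm. 6.3, §6 (`p ⊙ ⟨1,s,1⟩`),
  Thm. 7.3 (`⊕_{α,β} ⟨1,(n_α−1)(m_β−1),1⟩`). [AlmanLi2026]
* M. Bläser, *Fast Matrix Multiplication*, Theory of Computing Library, Graduate Surveys 5 (2013),
  Def. 7.2 / Lemma 5.4 (relabelling and zeroing-out restrictions), §5.1 (rotation). [Blaser2013]
-/

noncomputable section

open scoped BigOperators

namespace Literature.Computability.AlgebraicComplexity

universe u

variable {K : Type u} [CommSemiring K]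
variable {τ τ' ν ν' σ : Type*}

variable (K) in
/-- **Direct sum of one-slice tensors along a block map** `g : τ → ν`:
`blockSliceTensor K g = ⊕_{c ∈ ν} ⟨1, |g⁻¹(c)|, 1⟩` in coordinates — entry `1` at `(x, x, g x)`,
`0` elsewhere (`x`-variables and `y`-variables indexed by `τ`, one `w`-variable per block, trivial mode
third as for `⟨1,s,1⟩ = rotate (oneSliceTensor K σ)`). Alman–Li write these sums as
`⊕_α ⟨1, s_α, 1⟩` and, for `p` equal blocks, `p ⊙ ⟨1,s,1⟩`. [cite: AlmanLi2026, §5.3 and Thm. 6.3 / Thm. 7.3 (direct sums of one-slice tensors)] -/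
def blockSliceTensor [DecidableEq τ] [DecidableEq ν] (g : τ → ν) : τ → τ → ν → K :=
  fun x y c => if x = y ∧ g x = c then 1 else 0

/-- Entries of the block one-slice tensor. [cite: AlmanLi2026, §5.3] -/
@[simp] theorem blockSliceTensor_apply [DecidableEq τ] [DecidableEq ν] (g : τ → ν) (x y : τ) (c : ν) :
    blockSliceTensor K g x y c = if x = y ∧ g x = c then 1 else 0 := rfl

/-- **One block**: along the constant map to `Unit` the block one-slice tensor is the one-slice tensor
`⟨1, |τ|, 1⟩` itself (trivial mode third). [cite: AlmanLi2026, §5.3] -/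
theorem blockSliceTensor_const [DecidableEq τ] :
    blockSliceTensor K (fun _ : τ => ()) = rotate (oneSliceTensor K τ) := by
  funext x y c
  simp [rotate_apply, oneSliceTensor_apply]

/-- **Two groups of blocks**: if the blocks are labelled by `ν₁ ⊕ ν₂` (index sets `τ₁ ⊕ τ₂`, block map
`Sum.map g₁ g₂`), the block one-slice tensor IS the direct sum of the two block one-slice tensors.
[cite: AlmanLi2026, Thm. 6.3 (the appended `⊕_α ⟨1,s_α,1⟩`)] -/
theorem blockSliceTensor_sumMap {τ₁ τ₂ ν₁ ν₂ : Type*} [DecidableEq τ₁] [DecidableEq τ₂] [DecidableEq ν₁]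
    [DecidableEq ν₂] (g₁ : τ₁ → ν₁) (g₂ : τ₂ → ν₂) :
    blockSliceTensor K (Sum.map g₁ g₂) =
      directSumTensor (blockSliceTensor K g₁) (blockSliceTensor K g₂) := by
  funext x y c
  rcases x with x | x <;> rcases y with y | y <;> rcases c with c | c <;>
    simp [directSumTensor]

/-- **Equal blocks**: for `τ = Fin p × σ` and `g = Prod.fst`, the block one-slice tensor is the
Kronecker product `⟨p⟩ ⊠ ⟨1,|σ|,1⟩` (the paper's `p ⊙ ⟨1,s,1⟩`), the third mode `Fin p` of the former
being the third mode `Fin p × Unit` of the latter. [cite: AlmanLi2026, §6 (the summand `p ⊙ ⟨1,s,1⟩`)] -/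
theorem blockSliceTensor_fst [DecidableEq σ] (p : ℕ) (x y : Fin p × σ) (c : Fin p) :
    blockSliceTensor K (Prod.fst : Fin p × σ → Fin p) x y c =
      kroneckerTensor (unitTensor K p) (rotate (oneSliceTensor K σ)) x y (c, ()) := by
  obtain ⟨a, x⟩ := x
  obtain ⟨b, y⟩ := y
  simp only [blockSliceTensor_apply, Prod.mk.injEq, kroneckerTensor_apply, unitTensor_apply,
    rotate_apply, oneSliceTensor_apply, mul_ite, mul_one, mul_zero]
  by_cases hab : a = b
  · subst hab
    by_cases hac : a = c
    · subst hac
      by_cases hxy : x = y <;> simp [hxy]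
    · simp [hac]
  · simp [hab]

/-- `⟨p⟩ ⊠ ⟨1,|σ|,1⟩ ≥ blockSliceTensor K Prod.fst` (relabel the third mode along
`Fin p ≃ Fin p × Unit`). [cite: Blaser2013, Lemma 5.4] -/
theorem tensorRestrictsTo_kronecker_blockSliceTensor_fst [Fintype σ] [DecidableEq σ] (p : ℕ) :
    TensorRestrictsTo (kroneckerTensor (unitTensor K p) (rotate (oneSliceTensor K σ)))
      (blockSliceTensor K (Prod.fst : Fin p × σ → Fin p)) := by
  have e : blockSliceTensor K (Prod.fst : Fin p × σ → Fin p) = fun x y c =>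
      kroneckerTensor (unitTensor K p) (rotate (oneSliceTensor K σ)) (id x) (id y) (c, ()) := by
    funext x y c
    exact blockSliceTensor_fst p x y c
  rw [e]
  exact tensorRestrictsTo_precomp _ _ _ _

/-- `blockSliceTensor K Prod.fst ≥ ⟨p⟩ ⊠ ⟨1,|σ|,1⟩` (relabel the third mode along
`Fin p × Unit ≃ Fin p`). [cite: Blaser2013, Lemma 5.4] -/
theorem tensorRestrictsTo_blockSliceTensor_fst_kronecker [Fintype σ] [DecidableEq σ] (p : ℕ) :
    TensorRestrictsTo (blockSliceTensor K (Prod.fst : Fin p × σ → Fin p))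
      (kroneckerTensor (unitTensor K p) (rotate (oneSliceTensor K σ))) := by
  have e : kroneckerTensor (unitTensor K p) (rotate (oneSliceTensor K σ)) = fun x y (c : Fin p × Unit) =>
      blockSliceTensor K (Prod.fst : Fin p × σ → Fin p) (id x) (id y) c.1 := by
    funext x y c
    obtain ⟨c, u⟩ := c
    exact (blockSliceTensor_fst p x y c).symm
  rw [e]
  exact tensorRestrictsTo_precomp _ _ _ _

/-- **Monotonicity**: an injection `e : τ' → τ` of index sets over an injection `f : ν' → ν` of block
labels (`g ∘ e = f ∘ g'`) exhibits `blockSliceTensor K g'` as the restriction of `blockSliceTensor K g`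
deleting the other coordinates (`⟨1,s,1⟩ ≥ ⟨1,s',1⟩` for `s' ≤ s`, blockwise, and dropping blocks).
[cite: Blaser2013, Def. 7.2] -/
theorem tensorRestrictsTo_blockSliceTensor_of_comp_eq [Fintype τ] [Fintype ν] [DecidableEq τ]
    [DecidableEq ν] [DecidableEq τ'] [DecidableEq ν'] {g : τ → ν} {g' : τ' → ν'} {e : τ' → τ} {f : ν' → ν}
    (he : Function.Injective e) (hf : Function.Injective f) (h : ∀ x, g (e x) = f (g' x)) :
    TensorRestrictsTo (blockSliceTensor K g) (blockSliceTensor K g') := by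
  classical
  have eq : blockSliceTensor K g' = fun x y c => blockSliceTensor K g (e x) (e y) (f c) := by
    funext x y c
    simp only [blockSliceTensor_apply, he.eq_iff, h x, hf.eq_iff]
  rw [eq]
  exact tensorRestrictsTo_precomp _ _ _ _

/-- In particular `blockSliceTensor K g ≥ ⟨1, |g⁻¹(c)|, 1⟩` for every single block `c`
(the fibre `{x // g x = c}`). [cite: AlmanLi2026, §5.3] -/
theorem tensorRestrictsTo_blockSliceTensor_fibre [Fintype τ] [Fintype ν] [DecidableEq τ]
    [DecidableEq ν] (g : τ → ν) (c : ν) :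
    TensorRestrictsTo (blockSliceTensor K g) (rotate (oneSliceTensor K {x // g x = c})) := by
  rw [← blockSliceTensor_const]
  exact tensorRestrictsTo_blockSliceTensor_of_comp_eq (g' := fun _ : {x // g x = c} => ())
    (e := Subtype.val) (f := fun _ : Unit => c) Subtype.val_injective
    (fun _ _ _ => Subsingleton.elim _ _) (fun x => x.2)

end Literature.Computability.AlgebraicComplexity
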